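import Summits.Ventures.QEC.CircuitDistance.DEMCheckRel
import HarnessLib

/-!
# SOUNDNESS of the word-level checks: `undetectableW`, `logicalErrorW` ⟹ `Undetectable`, `LogicalError`

Cell `qec`, experiment CDX (engine seat qec-cdx-eng-1). The bridge from DEMCheck's word computations to the `Finset`
semantics of `SyndromeCycle.lean`: `bsum` over the `toFinset` of a duplicate-free list = XOR-fold; bits of the summed effect
words = `flipX`/`flipZ`/`dataX`/`dataZ`; the final TRUE-syndrome layer (`H^X β`, `H^Z α` over the tree's `BB.Code.HX = [A|B]`,
`HZ = [Bᵀ|Aᵀ]`) = bits of `synXW`/`synZW`; detector bridge `detX_eq_testBit`/`detZ_eq_testBit`;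
`undetectable_of_undetectableW`; logical-error witnesses (`not_mem_rowSpace_of_witness` with a word-encoded vector) giving
`logicalError_of_logicalErrorW`; and the WITNESS PRINCIPLE `hasLogicalFault_of_checks`. Nothing here changes a statement.
-/

namespace Summit.Ventures.QEC.CircuitDistance

open Literature.InformationTheory.QuantumCodes

variable {ℓ m : ℕ}

variable [NeZero ℓ] [NeZero m]

/-! ## Bridge: the word-level effect of a duplicate-free fault list represents the `Finset` effect of `SyndromeCycle` -/

omit [NeZero ℓ] [NeZero m] in
/-- `bsum` over `insert`. -/
theorem bsum_insert {a : Fault ℓ m} {F : Finset (Fault ℓ m)} (ha : a ∉ F) (g : Fault ℓ m → Bool) :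
    bsum (insert a F) g = xor (g a) (bsum F g) := by
  unfold bsum
  rw [Finset.filter_insert]
  by_cases hg : g a = true
  · rw [if_pos hg, Finset.card_insert_of_notMem (by simp [ha])]
    rw [hg]
    rcases Nat.mod_two_eq_zero_or_one (F.filter fun f => g f = true).card with h | h <;>
      simp [Nat.add_mod, h]
  · rw [if_neg hg]
    simp [hg]

omit [NeZero ℓ] [NeZero m] in
/-- `bsum` of the empty set. -/
@[simp] theorem bsum_empty (g : Fault ℓ m → Bool) : bsum (∅ : Finset (Fault ℓ m)) g = false := by
  simp [bsum]

omit [NeZero ℓ] [NeZero m] in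
/-- For a duplicate-free list, `bsum` over its `toFinset` is the XOR-fold over the list. -/
theorem bsum_toFinset (L : List (Fault ℓ m)) (hL : L.Nodup) (g : Fault ℓ m → Bool) :
    bsum L.toFinset g = L.foldr (fun f b => xor (g f) b) false := by
  induction L with
  | nil => simp
  | cons a L ih =>
    rw [List.nodup_cons] at hL
    rw [List.toFinset_cons, bsum_insert (by simpa using hL.1), List.foldr_cons, ih hL.2]

/-- Bits of the summed `X`-flip words = `flipX` of the `Finset`. -/
theorem testBit_effectWs_mX (S : SMCode ℓ m) (Nc : ℕ) (L : List (Fault ℓ m)) (hL : L.Nodup) (c : ℕ) (i : BB.Mono ℓ m) :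
    ((effectWs S Nc L).mX c).testBit (bitIdx i) = flipX S Nc L.toFinset c i := by
  unfold flipX
  rw [bsum_toFinset L hL]
  clear hL
  induction L with
  | nil => simp [effectWs, WEffect.zero]
  | cons a L ih =>
    simp only [effectWs, List.foldr_cons, WEffect.add, WState.effect, Nat.testBit_xor] at ih ⊢
    rw [ih, (rel_run S Nc a).hX c i]

/-- Bits of the summed `Z`-flip words = `flipZ` of the `Finset`. -/
theorem testBit_effectWs_mZ (S : SMCode ℓ m) (Nc : ℕ) (L : List (Fault ℓ m)) (hL : L.Nodup) (c : ℕ) (i : BB.Mono ℓ m) :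
    ((effectWs S Nc L).mZ c).testBit (bitIdx i) = flipZ S Nc L.toFinset c i := by
  unfold flipZ
  rw [bsum_toFinset L hL]
  clear hL
  induction L with
  | nil => simp [effectWs, WEffect.zero]
  | cons a L ih =>
    simp only [effectWs, List.foldr_cons, WEffect.add, WState.effect, Nat.testBit_xor] at ih ⊢
    rw [ih, (rel_run S Nc a).hZ c i]

/-- Generic: bits of an XOR-folded word family vs the XOR-fold of bits. -/
theorem testBit_foldr_effect (S : SMCode ℓ m) (Nc : ℕ) (L : List (Fault ℓ m)) (sel : WEffect → ℕ) (g : Fault ℓ m → Bool)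
    (hsel_zero : sel WEffect.zero = 0) (hsel_add : ∀ a b, sel (a.add b) = sel a ^^^ sel b) (j : ℕ)
    (hg : ∀ f, (sel (runW S Nc f).effect).testBit j = g f) :
    (sel (effectWs S Nc L)).testBit j = L.foldr (fun f b => xor (g f) b) false := by
  induction L with
  | nil => simp [effectWs, hsel_zero]
  | cons a L ih =>
    unfold effectWs at ih ⊢
    rw [List.foldr_cons, hsel_add, Nat.testBit_xor, hg a, ih, List.foldr_cons]

/-- Bits of the summed residual `x`-word on `q(L)`. -/
theorem testBit_effectWs_xL (S : SMCode ℓ m) (Nc : ℕ) (L : List (Fault ℓ m)) (hL : L.Nodup) (i : BB.Mono ℓ m) :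
    ((effectWs S Nc L).xL).testBit (bitIdx i) = bsum L.toFinset (fun f => ((run1 S Nc f).frame (Reg.L, i)).1) := by
  rw [bsum_toFinset L hL]
  exact testBit_foldr_effect S Nc L WEffect.xL _ rfl (fun _ _ => rfl) _ (fun f => ((rel_run S Nc f).fx Reg.L i).symm)

/-- Bits of the summed residual `x`-word on `q(R)`. -/
theorem testBit_effectWs_xR (S : SMCode ℓ m) (Nc : ℕ) (L : List (Fault ℓ m)) (hL : L.Nodup) (i : BB.Mono ℓ m) :
    ((effectWs S Nc L).xR).testBit (bitIdx i) = bsum L.toFinset (fun f => ((run1 S Nc f).frame (Reg.R, i)).1) := by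
  rw [bsum_toFinset L hL]
  exact testBit_foldr_effect S Nc L WEffect.xR _ rfl (fun _ _ => rfl) _ (fun f => ((rel_run S Nc f).fx Reg.R i).symm)

/-- Bits of the summed residual `z`-word on `q(L)`. -/
theorem testBit_effectWs_zL (S : SMCode ℓ m) (Nc : ℕ) (L : List (Fault ℓ m)) (hL : L.Nodup) (i : BB.Mono ℓ m) :
    ((effectWs S Nc L).zL).testBit (bitIdx i) = bsum L.toFinset (fun f => ((run1 S Nc f).frame (Reg.L, i)).2) := by
  rw [bsum_toFinset L hL]
  exact testBit_foldr_effect S Nc L WEffect.zL _ rfl (fun _ _ => rfl) _ (fun f => ((rel_run S Nc f).fz Reg.L i).symm)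

/-- Bits of the summed residual `z`-word on `q(R)`. -/
theorem testBit_effectWs_zR (S : SMCode ℓ m) (Nc : ℕ) (L : List (Fault ℓ m)) (hL : L.Nodup) (i : BB.Mono ℓ m) :
    ((effectWs S Nc L).zR).testBit (bitIdx i) = bsum L.toFinset (fun f => ((run1 S Nc f).frame (Reg.R, i)).2) := by
  rw [bsum_toFinset L hL]
  exact testBit_foldr_effect S Nc L WEffect.zR _ rfl (fun _ _ => rfl) _ (fun f => ((rel_run S Nc f).fz Reg.R i).symm)

/-- `dataX` on the left block, as a Boolean. -/
theorem dataX_inl (S : SMCode ℓ m) (Nc : ℕ) (F : Finset (Fault ℓ m)) (i : BB.Mono ℓ m) :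
    dataX S Nc F (Sum.inl i) = if bsum F (fun f => ((run1 S Nc f).frame (Reg.L, i)).1) then 1 else 0 := rfl
/-- `dataX` on the right block. -/
theorem dataX_inr (S : SMCode ℓ m) (Nc : ℕ) (F : Finset (Fault ℓ m)) (i : BB.Mono ℓ m) :
    dataX S Nc F (Sum.inr i) = if bsum F (fun f => ((run1 S Nc f).frame (Reg.R, i)).1) then 1 else 0 := rfl
/-- `dataZ` on the left block. -/
theorem dataZ_inl (S : SMCode ℓ m) (Nc : ℕ) (F : Finset (Fault ℓ m)) (i : BB.Mono ℓ m) :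
    dataZ S Nc F (Sum.inl i) = if bsum F (fun f => ((run1 S Nc f).frame (Reg.L, i)).2) then 1 else 0 := rfl
/-- `dataZ` on the right block. -/
theorem dataZ_inr (S : SMCode ℓ m) (Nc : ℕ) (F : Finset (Fault ℓ m)) (i : BB.Mono ℓ m) :
    dataZ S Nc F (Sum.inr i) = if bsum F (fun f => ((run1 S Nc f).frame (Reg.R, i)).2) then 1 else 0 := rfl

/-! ## The final-layer syndromes: `synXW` / `synZW` compute `H^X β` / `H^Z α` -/

omit [NeZero ℓ] [NeZero m] in
/-- Sum of a shifted indicator against a vector: `Σ_j [j − i = c] · w j = w (i + c)`. -/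
theorem sum_single_sub_mul [NeZero ℓ] [NeZero m] (c i : BB.Mono ℓ m) (w : BB.Mono ℓ m → ZMod 2) :
    ∑ j, (Pi.single c (1 : ZMod 2) : BB.Mono ℓ m → ZMod 2) (j - i) * w j = w (i + c) := by
  have : ∀ j, (Pi.single c (1 : ZMod 2) : BB.Mono ℓ m → ZMod 2) (j - i) * w j = if j = i + c then w j else 0 := by
    intro j
    by_cases h : j = i + c
    · subst h; simp
    · have hne : j - i ≠ c := fun e => h (by rw [← e]; abel)
      rw [if_neg h, Pi.single_apply, if_neg hne, zero_mul]
  simp_rw [this]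
  simp

/-- The polynomial `A` of `S` evaluated: indicator of the three monomials. -/
theorem polyA_apply (S : SMCode ℓ m) (g : BB.Mono ℓ m) :
    S.polyA g = (Pi.single (S.amon 0) (1 : ZMod 2) : BB.Mono ℓ m → ZMod 2) g +
      (Pi.single (S.amon 1) (1 : ZMod 2) : BB.Mono ℓ m → ZMod 2) g +
      (Pi.single (S.amon 2) (1 : ZMod 2) : BB.Mono ℓ m → ZMod 2) g := by
  simp [SMCode.polyA, BB.monomial]

/-- The polynomial `B` of `S` evaluated. -/
theorem polyB_apply (S : SMCode ℓ m) (g : BB.Mono ℓ m) :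
    S.polyB g = (Pi.single (S.bmon 0) (1 : ZMod 2) : BB.Mono ℓ m → ZMod 2) g +
      (Pi.single (S.bmon 1) (1 : ZMod 2) : BB.Mono ℓ m → ZMod 2) g +
      (Pi.single (S.bmon 2) (1 : ZMod 2) : BB.Mono ℓ m → ZMod 2) g := by
  simp [SMCode.polyB, BB.monomial]

/-- `H^X` of `QC(A,B)` applied to a data vector: the six support entries of `X`-check `i`. -/
theorem HX_mulVec_apply (S : SMCode ℓ m) (v : BB.Mono ℓ m ⊕ BB.Mono ℓ m → ZMod 2) (i : BB.Mono ℓ m) :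
    (S.toCode.HX.mulVec v) i = v (.inl (i + S.amon 0)) + v (.inl (i + S.amon 1)) + v (.inl (i + S.amon 2)) +
      (v (.inr (i + S.bmon 0)) + v (.inr (i + S.bmon 1)) + v (.inr (i + S.bmon 2))) := by
  rw [BB.Code.HX_eq]
  simp only [Matrix.mulVec, dotProduct, Fintype.sum_sum_type, Matrix.fromCols_apply_inl, Matrix.fromCols_apply_inr,
    BB.toMatrix_apply, SMCode.toCode]
  simp only [polyA_apply, polyB_apply, add_mul, Finset.sum_add_distrib, sum_single_sub_mul]

/-- `H^Z = [Bᵀ | Aᵀ]` applied to a data vector: the six support entries of `Z`-check `i`. -/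
theorem HZ_mulVec_apply (S : SMCode ℓ m) (v : BB.Mono ℓ m ⊕ BB.Mono ℓ m → ZMod 2) (i : BB.Mono ℓ m) :
    (S.toCode.HZ.mulVec v) i = v (.inl (i - S.bmon 0)) + v (.inl (i - S.bmon 1)) + v (.inl (i - S.bmon 2)) +
      (v (.inr (i - S.amon 0)) + v (.inr (i - S.amon 1)) + v (.inr (i - S.amon 2))) := by
  rw [BB.Code.HZ_eq]
  simp only [Matrix.mulVec, dotProduct, Fintype.sum_sum_type, Matrix.fromCols_apply_inl, Matrix.fromCols_apply_inr,
    Matrix.transpose_apply, BB.toMatrix_apply, SMCode.toCode]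
  have key : ∀ (c : BB.Mono ℓ m) (w : BB.Mono ℓ m → ZMod 2),
      ∑ j, (Pi.single c (1 : ZMod 2) : BB.Mono ℓ m → ZMod 2) (i - j) * w j = w (i - c) := by
    intro c w
    have : ∀ j, (Pi.single c (1 : ZMod 2) : BB.Mono ℓ m → ZMod 2) (i - j) * w j = if j = i - c then w j else 0 := by
      intro j
      by_cases h : j = i - c
      · subst h; simp
      · have hne : i - j ≠ c := fun e => h (by rw [← e]; abel)
        rw [if_neg h, Pi.single_apply, if_neg hne, zero_mul]
    simp_rw [this]; simp
  simp only [polyA_apply, polyB_apply, add_mul, Finset.sum_add_distrib, key]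

/-- Six indicator values in `𝔽₂` sum to `1` iff the XOR of the Booleans is `true`. -/
theorem ite_sum6_eq_one_iff (b₁ b₂ b₃ b₄ b₅ b₆ : Bool) :
    decide (((if b₁ then (1 : ZMod 2) else 0) + (if b₂ then 1 else 0) + (if b₃ then 1 else 0) +
      ((if b₄ then 1 else 0) + (if b₅ then 1 else 0) + (if b₆ then 1 else 0))) = 1) =
      (((((b₁ ^^ b₂) ^^ b₃) ^^ b₄) ^^ b₅) ^^ b₆) := by
  revert b₁ b₂ b₃ b₄ b₅ b₆; decide

/-- Six indicator values in `𝔽₂` sum to `0` iff the XOR of the Booleans is `false`. -/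
theorem ite_sum6_eq_zero_iff (b₁ b₂ b₃ b₄ b₅ b₆ : Bool) :
    (((if b₁ then (1 : ZMod 2) else 0) + (if b₂ then 1 else 0) + (if b₃ then 1 else 0) +
      ((if b₄ then 1 else 0) + (if b₅ then 1 else 0) + (if b₆ then 1 else 0))) = 0) ↔
      (((((b₁ ^^ b₂) ^^ b₃) ^^ b₄) ^^ b₅) ^^ b₆) = false := by
  revert b₁ b₂ b₃ b₄ b₅ b₆; decide

/-- Bits of `synXW`: the XOR of the six `z`-bits on the support of `X`-check `i`. -/
theorem testBit_synXW (S : SMCode ℓ m) (zL zR : ℕ) (i : BB.Mono ℓ m) :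
    (synXW S zL zR).testBit (bitIdx i) =
      ((((((zL.testBit (bitIdx (i + S.amon 0))) ^^ zL.testBit (bitIdx (i + S.amon 1))) ^^ zL.testBit (bitIdx (i + S.amon 2))) ^^
        zR.testBit (bitIdx (i + S.bmon 0))) ^^ zR.testBit (bitIdx (i + S.bmon 1))) ^^ zR.testBit (bitIdx (i + S.bmon 2))) := by
  simp only [synXW, Nat.testBit_xor, testBit_translateW, sub_neg_eq_add]

/-- Bits of `synZW`: the XOR of the six `x`-bits on the support of `Z`-check `i`. -/
theorem testBit_synZW (S : SMCode ℓ m) (xL xR : ℕ) (i : BB.Mono ℓ m) :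
    (synZW S xL xR).testBit (bitIdx i) =
      ((((((xL.testBit (bitIdx (i - S.bmon 0))) ^^ xL.testBit (bitIdx (i - S.bmon 1))) ^^ xL.testBit (bitIdx (i - S.bmon 2))) ^^
        xR.testBit (bitIdx (i - S.amon 0))) ^^ xR.testBit (bitIdx (i - S.amon 1))) ^^ xR.testBit (bitIdx (i - S.amon 2))) := by
  simp only [synZW, Nat.testBit_xor, testBit_translateW]

/-- The final TRUE syndrome of the residual `Z`-error, bitwise: `(H^X β)_i = 1` iff bit `i` of `synXW`. -/
theorem decide_HX_dataZ (S : SMCode ℓ m) (Nc : ℕ) (L : List (Fault ℓ m)) (hL : L.Nodup) (i : BB.Mono ℓ m) :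
    decide ((S.toCode.HX.mulVec (dataZ S Nc L.toFinset)) i = 1) =
      (synXW S (effectWs S Nc L).zL (effectWs S Nc L).zR).testBit (bitIdx i) := by
  rw [HX_mulVec_apply, testBit_synXW]
  simp only [dataZ_inl, dataZ_inr, testBit_effectWs_zL S Nc L hL, testBit_effectWs_zR S Nc L hL]
  exact ite_sum6_eq_one_iff _ _ _ _ _ _

/-- The final TRUE syndrome of the residual `X`-error, bitwise. -/
theorem decide_HZ_dataX (S : SMCode ℓ m) (Nc : ℕ) (L : List (Fault ℓ m)) (hL : L.Nodup) (i : BB.Mono ℓ m) :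
    decide ((S.toCode.HZ.mulVec (dataX S Nc L.toFinset)) i = 1) =
      (synZW S (effectWs S Nc L).xL (effectWs S Nc L).xR).testBit (bitIdx i) := by
  rw [HZ_mulVec_apply, testBit_synZW]
  simp only [dataX_inl, dataX_inr, testBit_effectWs_xL S Nc L hL, testBit_effectWs_xR S Nc L hL]
  exact ite_sum6_eq_one_iff _ _ _ _ _ _

/-- DETECTOR BRIDGE (`X`-checks): the `Finset` detector equals the bit of the detector word. -/
theorem detX_eq_testBit (S : SMCode ℓ m) (Nc : ℕ) (L : List (Fault ℓ m)) (hL : L.Nodup) (t : ℕ) (i : BB.Mono ℓ m) :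
    detX S Nc L.toFinset t i = ((effectWs S Nc L).detX S Nc t).testBit (bitIdx i) := by
  unfold detX WEffect.detX
  by_cases h0 : t = 0
  · simp [h0]
  rw [if_neg h0, if_neg h0]
  by_cases h1 : t ≤ Nc
  · rw [if_pos h1, if_pos h1, Nat.testBit_xor, testBit_effectWs_mX S Nc L hL, testBit_effectWs_mX S Nc L hL]
  rw [if_neg h1, if_neg h1]
  by_cases h2 : t = Nc + 1
  · rw [if_pos h2, if_pos h2, Nat.testBit_xor, decide_HX_dataZ S Nc L hL, testBit_effectWs_mX S Nc L hL]
  · rw [if_neg h2, if_neg h2]; simp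

/-- DETECTOR BRIDGE (`Z`-checks). -/
theorem detZ_eq_testBit (S : SMCode ℓ m) (Nc : ℕ) (L : List (Fault ℓ m)) (hL : L.Nodup) (t : ℕ) (i : BB.Mono ℓ m) :
    detZ S Nc L.toFinset t i = ((effectWs S Nc L).detZ S Nc t).testBit (bitIdx i) := by
  unfold detZ WEffect.detZ
  by_cases h0 : t = 0
  · simp [h0]
  rw [if_neg h0, if_neg h0]
  by_cases h1 : t ≤ Nc
  · rw [if_pos h1, if_pos h1, Nat.testBit_xor, testBit_effectWs_mZ S Nc L hL, testBit_effectWs_mZ S Nc L hL]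
  rw [if_neg h1, if_neg h1]
  by_cases h2 : t = Nc + 1
  · rw [if_pos h2, if_pos h2, Nat.testBit_xor, decide_HZ_dataX S Nc L hL, testBit_effectWs_mZ S Nc L hL]
  · rw [if_neg h2, if_neg h2]; simp

/-- **SOUNDNESS OF THE UNDETECTABILITY CHECK**: if the word-level check accepts a duplicate-free fault list, the fault
set is `Undetectable` in the sense of `SyndromeCycle.lean`. -/
theorem undetectable_of_undetectableW (S : SMCode ℓ m) (Nc : ℕ) (L : List (Fault ℓ m)) (hL : L.Nodup)
    (h : undetectableW S Nc L = true) : Undetectable S Nc L.toFinset := by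
  unfold undetectableW at h
  simp only [Bool.and_eq_true, List.all_eq_true, beq_iff_eq] at h
  obtain ⟨⟨⟨hev, hdet⟩, _⟩, _⟩ := h
  refine ⟨?_, ?_⟩
  · intro f hf
    have := hev f (List.mem_toFinset.1 hf)
    simpa using this
  · intro t i
    by_cases ht : t ≤ Nc + 1
    · obtain ⟨hx, hz⟩ := hdet t (List.mem_range.2 (by omega))
      rw [detX_eq_testBit S Nc L hL, detZ_eq_testBit S Nc L hL, hx, hz]
      simp
    · have h0 : t ≠ 0 := by omega
      have h1 : ¬ t ≤ Nc := by omega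
      have h2 : t ≠ Nc + 1 := by omega
      simp [detX, detZ, h0, h1, h2]

/-! ## Logical-error witnesses on words -/

/-- `H^X u = 0` for the word vector `u` when `synXW S uL uR = 0`. -/
theorem HX_mulVec_vecOfWords_eq_zero (S : SMCode ℓ m) (uL uR : ℕ) (h : synXW S uL uR = 0) :
    S.toCode.HX.mulVec (vecOfWords uL uR) = 0 := by
  funext i
  have hb := testBit_synXW S uL uR i
  rw [h, Nat.zero_testBit] at hb
  rw [HX_mulVec_apply]
  simp only [vecOfWords, Sum.elim_inl, Sum.elim_inr, Pi.zero_apply]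
  exact (ite_sum6_eq_zero_iff _ _ _ _ _ _).2 hb.symm

/-- `H^Z u = 0` for the word vector `u` when `synZW S uL uR = 0`. -/
theorem HZ_mulVec_vecOfWords_eq_zero (S : SMCode ℓ m) (uL uR : ℕ) (h : synZW S uL uR = 0) :
    S.toCode.HZ.mulVec (vecOfWords uL uR) = 0 := by
  funext i
  have hb := testBit_synZW S uL uR i
  rw [h, Nat.zero_testBit] at hb
  rw [HZ_mulVec_apply]
  simp only [vecOfWords, Sum.elim_inl, Sum.elim_inr, Pi.zero_apply]
  exact (ite_sum6_eq_zero_iff _ _ _ _ _ _).2 hb.symm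

/-- The overlap of a word vector with a word-represented data error is the indicator of `oddOverlap`. -/
theorem vecOfWords_dotProduct (uL uR vL vR : ℕ) (v : BB.Mono ℓ m ⊕ BB.Mono ℓ m → ZMod 2)
    (hvL : ∀ i, v (.inl i) = if vL.testBit (bitIdx i) then 1 else 0)
    (hvR : ∀ i, v (.inr i) = if vR.testBit (bitIdx i) then 1 else 0) :
    dotProduct (vecOfWords uL uR) v = if oddOverlap (ℓ * m) uL uR vL vR then 1 else 0 := by
  simp only [dotProduct, Fintype.sum_sum_type, vecOfWords, Sum.elim_inl, Sum.elim_inr, hvL, hvR, ite_mul_ite]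
  have hL : ∑ i : BB.Mono ℓ m, (if (uL.testBit (bitIdx i) && vL.testBit (bitIdx i)) then (1 : ZMod 2) else 0) =
      if wordParity (ℓ * m) (uL &&& vL) then 1 else 0 := by
    rw [← sum_range_ite_testBit]
    rw [← sum_mono_eq_sum_range (fun j => if (uL &&& vL).testBit j then (1 : ZMod 2) else 0)]
    simp [Nat.testBit_and]
  have hR : ∑ i : BB.Mono ℓ m, (if (uR.testBit (bitIdx i) && vR.testBit (bitIdx i)) then (1 : ZMod 2) else 0) =
      if wordParity (ℓ * m) (uR &&& vR) then 1 else 0 := by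
    rw [← sum_range_ite_testBit]
    rw [← sum_mono_eq_sum_range (fun j => if (uR &&& vR).testBit j then (1 : ZMod 2) else 0)]
    simp [Nat.testBit_and]
  rw [hL, hR, ite_add_ite, Bool.xor_comm]
  rfl

/-- **SOUNDNESS OF THE LOGICAL-ERROR CHECK**: an accepted word-level witness proves `LogicalError`. -/
theorem logicalError_of_logicalErrorW (S : SMCode ℓ m) (Nc : ℕ) (L : List (Fault ℓ m)) (hL : L.Nodup)
    (sector : Bool) (uL uR : ℕ) (h : logicalErrorW S Nc L sector uL uR = true) : LogicalError S Nc L.toFinset := by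
  unfold logicalErrorW at h
  unfold LogicalError
  cases sector with
  | true =>
    simp only [↓reduceIte, Bool.and_eq_true, beq_iff_eq] at h
    obtain ⟨hsyn, hodd⟩ := h
    intro hmem
    have hu := HX_mulVec_vecOfWords_eq_zero S uL uR hsyn
    have hdot : dotProduct (vecOfWords uL uR) (dataX S Nc L.toFinset) ≠ 0 := by
      rw [vecOfWords_dotProduct uL uR (effectWs S Nc L).xL (effectWs S Nc L).xR]
      · rw [hodd]; decide
      · intro i; rw [dataX_inl, ← testBit_effectWs_xL S Nc L hL]
      · intro i; rw [dataX_inr, ← testBit_effectWs_xR S Nc L hL]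
    exact not_mem_rowSpace_of_witness (vecOfWords uL uR) hu hdot hmem.1
  | false =>
    simp only [Bool.false_eq_true, ↓reduceIte, Bool.and_eq_true, beq_iff_eq] at h
    obtain ⟨hsyn, hodd⟩ := h
    intro hmem
    have hu := HZ_mulVec_vecOfWords_eq_zero S uL uR hsyn
    have hdot : dotProduct (vecOfWords uL uR) (dataZ S Nc L.toFinset) ≠ 0 := by
      rw [vecOfWords_dotProduct uL uR (effectWs S Nc L).zL (effectWs S Nc L).zR]
      · rw [hodd]; decide
      · intro i; rw [dataZ_inl, ← testBit_effectWs_zL S Nc L hL]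
      · intro i; rw [dataZ_inr, ← testBit_effectWs_zR S Nc L hL]
    exact not_mem_rowSpace_of_witness (vecOfWords uL uR) hu hdot hmem.2

/-- **WITNESS PRINCIPLE**: a duplicate-free fault list accepted by both word-level checks realises an undetectable logical
fault set of `faultCount ≤ L.length` in the `Nc`-cycle circuit, hence `HasLogicalFaultOfWeightAtMostAt S Nc L.length`. -/
theorem hasLogicalFault_of_checks (S : SMCode ℓ m) (Nc : ℕ) (L : List (Fault ℓ m)) (hL : L.Nodup)
    (sector : Bool) (uL uR : ℕ) (hund : undetectableW S Nc L = true) (hlog : logicalErrorW S Nc L sector uL uR = true) :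
    HasLogicalFaultOfWeightAtMostAt S Nc L.length := by
  refine ⟨L.toFinset, undetectable_of_undetectableW S Nc L hL hund, logicalError_of_logicalErrorW S Nc L hL sector uL uR hlog, ?_⟩
  unfold faultCount
  calc (L.toFinset.image Fault.loc).card ≤ L.toFinset.card := Finset.card_image_le
    _ ≤ L.length := List.toFinset_card_le L

end Summit.Ventures.QEC.CircuitDistance
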